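import Literature.Topology.FourManifolds.RegularLevelSplitting
import Literature.Topology.FourManifolds.BoundaryOrientation
import HarnessLib

/-!
# The identification `∂Mᵃ ≅ ∂M_a` reverses the boundary orientations

Topic `Literature/Topology/FourManifolds`; general differential topology written for the fact
seat `provefact-Literature.Topology.FourManifolds.nonempty_diffeomorph_sphere_four_of_sblf_genus_one_noLefschetz`
(Baykur–Kamada 2015, Lemma 11: the torus assembly step of the classification of closed
oriented surfaces cut along a regular level, `SurfaceLevelCylinders.lean`).  Everything here is
**proved**.

## Mathematics

Let `M` be a `C^∞` manifold without boundary (model `𝓡 (k + 1)`), `f : M → ℝ` smooth, `a` a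
regular level (`h : IsRegularLevel (𝓡 (k + 1)) f a`) and `o` a smooth orientation of `M`.  The
regular sublevel set `Mᵃ = {f ≤ a}` and the regular superlevel set `M_a = {a ≤ f} = {a - f ≤ 0}`
(`RegularLevelSplitting.lean`) are manifolds with boundary `f⁻¹(a)`, oriented by restriction of
`o` (`RegularSublevel.orientation h o`, pullback along the inclusion), and their boundaries carry
the induced boundary orientations, outward normal first (`SmoothOrientation.boundary`,
`BoundaryOrientation.lean`).  **The canonical identification
`RegularSublevel.splitDiffeomorph h : ∂Mᵃ ≅ ∂M_a` (the identity on points of `f⁻¹(a)`) is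
orientation *reversing*** for these boundary orientations: the outward normal of `Mᵃ` along
`f⁻¹(a)` points up the gradient of `f`, that of `M_a` points down, so the two boundary
orientations of the level `f⁻¹(a)` are opposite.  This is the sign behind "`M = Mᵃ ∪ M_a` is
an oriented gluing: the pieces induce opposite orientations on the common boundary" (Hirsch,
*Differential Topology* (1976), §4.4, p. 103 and Ch. 8 §2; Milnor, *Lectures on the h-cobordism
theorem* (1965), §1, oriented cobordisms `(W; V₀, V₁)` with `∂W = V₀ ⊔ (-V₁)`; Guillemin–Pollack,
*Differential Topology* (1974), Ch. 3 §2, p. 101, "the boundary orientations from the two sides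
of a hypersurface are opposite").

**Proof.** Fix a boundary point `z` of `Mᵃ` over `x ∈ f⁻¹(a)` and let `Θ₁`, `Θ₂` be the half-slice
charts of `Mᵃ` at `z` and of `M_a` at `σ z` (`σ = splitDiffeomorph h`); their `0`-th coordinates
are `a - f` and `f - a` respectively (`sublevelAtlas'_datum_apply_zero_of_eq`).  Near `z` the
map `σ` is the boundary restriction of the *local reflection* `Φ = Θ₁⁻¹ ∘ R ∘ Θ₁ : Mᵃ → M_a`
(`R` negates the `0`-th coordinate), which read in the charts `Θ₁`, `Θ₂` is
`τ = (Θ₂ ∘ Θ₁⁻¹) ∘ R`, a local diffeomorphism of the half-space `{0 ≤ y 0}` onto itself.  By the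
core lemma of `BoundaryOrientation.lean` (`BoundaryManifold.hasFDerivAt_boundaryCharts`: the
Jacobian of a boundary-preserving map at a boundary point is block triangular with positive
normal entry), the Jacobian of `σ` in the boundary charts has the sign of
`det dτ = det d(Θ₂ ∘ Θ₁⁻¹) · det R = -det d(Θ₂ ∘ Θ₁⁻¹)`.  On the other hand the orientations of
`Mᵃ`, `M_a` at `z`, `σ z` are `±o x` according to the signs of the Jacobians `J₁`, `J₂` of the two
inclusions read in `Θ₁`, `Θ₂` and the chart `c` of `M` at `x`, and `J₁ = J₂ ∘ d(Θ₂ ∘ Θ₁⁻¹)`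
(chain rule for `c ∘ Θ₁⁻¹ = (c ∘ Θ₂⁻¹) ∘ (Θ₂ ∘ Θ₁⁻¹)`).  So `σ` has positive Jacobian exactly
when `J₁`, `J₂` have opposite signs, i.e. exactly when the two boundary orientations at `z`
*disagree* — which says that `σ` is orientation reversing.

## Main results

* `Literature.Topology.FourManifolds.reflZero` — the reflection `R` of `ℝᵏ⁺¹` in the hyperplane
  `{y 0 = 0}`, `det R = -1` (`det_reflZero`).
* `Literature.Topology.FourManifolds.RegularSublevel.mfderiv_incl_eq_fderiv` — the differential
  of the inclusion `Mᵃ → M` at `p` is the derivative of `c ∘ Θₚ⁻¹` (`c` the chart of `M`, `Θₚ` the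
  half-slice chart at `p`).
* `Literature.Topology.FourManifolds.RegularSublevel.isOrientationReversing_splitDiffeomorph` —
  **the theorem**: `splitDiffeomorph h` reverses the boundary orientations
  `(orientation h o).boundary`, `(orientation h.const_sub o).boundary`.
* `Literature.Topology.FourManifolds.RegularSublevel.isOrientationPreserving_splitDiffeomorph_neg`
  — equivalently, it preserves them after reversing the orientation of one side.

## References

* M. W. Hirsch, *Differential Topology*, GTM 33, Springer (1976), Ch. 4 §4, p. 103 (boundary
  orientation, outward normal first); Ch. 8 §2 (gluing oriented manifolds along boundary
  components). [HirschDT1976]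
* J. Milnor, *Lectures on the h-cobordism theorem*, Princeton (1965), §1 (oriented cobordism,
  gluing along a common boundary, Thm. 1.4). [MilnorHCobordism1965]
* V. Guillemin, A. Pollack, *Differential Topology*, Prentice-Hall (1974), Ch. 3 §2, pp. 97–101
  (boundary orientation; opposite orientations from the two sides). [GuilleminPollack1974]
* J. M. Lee, *Introduction to Smooth Manifolds*, 2nd ed., GTM 218 (2013), Prop. 15.24 and
  Prop. 5.47 (regular sublevel sets are regular domains). [LeeSmoothManifolds2013]
-/

open scoped Manifold ContDiff Topology
open Function Set Filter Module

noncomputable section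

namespace Literature.Topology.FourManifolds

universe u

/-- Local notation: `𝔼 n` is the model Euclidean space `EuclideanSpace ℝ (Fin n)`. -/
local notation "𝔼 " n:arg => EuclideanSpace ℝ (Fin n)
/-- Local notation: `ℍ n` is the model half-space `EuclideanHalfSpace n`. -/
local notation "ℍ " n:arg => EuclideanHalfSpace n

/-! ### §1 The reflection of `ℝᵏ⁺¹` in the hyperplane `{y 0 = 0}` -/

section Reflection

open BoundaryManifold

variable {k : ℕ}

variable (k) in
/-- The reflection `R (t, u) = (-t, u)` of `ℝᵏ⁺¹ = ℝ e₀ ⊕ ℝᵏ` in the hyperplane `{y 0 = 0}`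
(negate the `0`-th coordinate, keep the tail), as a continuous linear map. [folklore] -/
def reflZero : 𝔼 (k + 1) →L[ℝ] 𝔼 (k + 1) :=
  (consCLE k : (𝔼 k × ℝ) →L[ℝ] 𝔼 (k + 1)).comp
    (((ContinuousLinearMap.fst ℝ (𝔼 k) ℝ).prod (-ContinuousLinearMap.snd ℝ (𝔼 k) ℝ)).comp
      ((consCLE k).symm : 𝔼 (k + 1) →L[ℝ] (𝔼 k × ℝ)))

/-- `R y = (-(y 0), tail y)`. [folklore] -/
theorem reflZero_apply (y : 𝔼 (k + 1)) : reflZero k y = consCLE k (tail k y, -(y 0)) := rfl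

/-- The `0`-th coordinate of `R y` is `-(y 0)`. [folklore] -/
@[simp]
theorem reflZero_apply_zero (y : 𝔼 (k + 1)) : reflZero k y 0 = -(y 0) := by
  rw [reflZero_apply, consCLE_apply_zero]

/-- `R` does not change the tail. [folklore] -/
@[simp]
theorem tail_reflZero (y : 𝔼 (k + 1)) : tail k (reflZero k y) = tail k y := by
  rw [reflZero_apply, tail_consCLE]

/-- `R` is an involution. [folklore] -/
@[simp]
theorem reflZero_reflZero (y : 𝔼 (k + 1)) : reflZero k (reflZero k y) = y := by
  rw [reflZero_apply, tail_reflZero, reflZero_apply_zero, neg_neg, consCLE_tail]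

/-- `R` fixes the hyperplane `{y 0 = 0}` pointwise. [folklore] -/
theorem reflZero_of_apply_zero_eq_zero {y : 𝔼 (k + 1)} (hy : y 0 = 0) : reflZero k y = y := by
  rw [reflZero_apply, hy, neg_zero, consCLE_tail_of_eq_zero k hy]

/-- `R (0, u) = (0, u)`. [folklore] -/
@[simp]
theorem reflZero_consZeroL (u : 𝔼 k) : reflZero k (consZeroL k u) = consZeroL k u :=
  reflZero_of_apply_zero_eq_zero (consZeroL_apply_zero u)

/-- `R e₀ = -e₀`, so `(R e₀) 0 = -1`. [folklore] -/
theorem reflZero_e0_apply_zero : reflZero k (e0 k) 0 = -1 := by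
  rw [reflZero_apply_zero, e0_apply_zero]

/-- **`det R = -1`** (block computation `det R = (R e₀) 0 · det (R|hyperplane) = -1 · 1`,
`det_eq_mul_det_of_comp_consZeroL`). [folklore] -/
theorem det_reflZero :
    LinearMap.det (reflZero k : 𝔼 (k + 1) →ₗ[ℝ] 𝔼 (k + 1)) = -1 := by
  have h : (reflZero k).comp (consZeroL k) =
      (consZeroL k).comp (ContinuousLinearMap.id ℝ (𝔼 k)) := by
    ext1 u
    simp only [ContinuousLinearMap.comp_apply, reflZero_consZeroL, ContinuousLinearMap.id_apply]
  rw [det_eq_mul_det_of_comp_consZeroL (reflZero k) (ContinuousLinearMap.id ℝ (𝔼 k)) h,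
    reflZero_e0_apply_zero, ContinuousLinearMap.coe_id, LinearMap.det_id, mul_one]

/-- `R` is continuous. [folklore] -/
theorem continuous_reflZero : Continuous (reflZero k) := (reflZero k).continuous

end Reflection


/-! ### §2 The differential of the inclusion `Mᵃ → M` in a half-slice chart -/

section Inclusion

variable {k : ℕ} {M : Type u} [TopologicalSpace M] [ChartedSpace (𝔼 (k + 1)) M]
  [IsManifold (𝓡 (k + 1)) ∞ M] {f : M → ℝ} {a : ℝ} (h : IsRegularLevel (𝓡 (k + 1)) f a)

namespace RegularSublevel

omit [IsManifold (𝓡 (k + 1)) ∞ M] in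
/-- The set where the local expression `c ∘ D.Θ⁻¹` of the inclusion (`D` a half-slice chart of
`{f ≤ a}`, `c` the extended chart of `M` at `x`) is defined is open. [folklore] -/
theorem isOpen_target_inter_symm_preimage_chart (D : HalfSliceChart (𝓡 (k + 1)) (f ⁻¹' Iic a))
    (x : M) : IsOpen (D.Θ.target ∩ D.Θ.symm ⁻¹' (chartAt (𝔼 (k + 1)) x).source) :=
  D.Θ.isOpen_inter_preimage_symm (chartAt _ x).open_source

/-- The local expression `c ∘ D.Θ⁻¹` of the inclusion `{f ≤ a} → M` (`D` a half-slice chart,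
`c` the extended chart of `M` at `x`) is smooth where defined. [folklore] -/
theorem contDiffOn_extChartAt_comp_symm (D : HalfSliceChart (𝓡 (k + 1)) (f ⁻¹' Iic a)) (x : M) :
    ContDiffOn ℝ ∞ (extChartAt (𝓡 (k + 1)) x ∘ D.Θ.symm)
      (D.Θ.target ∩ D.Θ.symm ⁻¹' (chartAt (𝔼 (k + 1)) x).source) := by
  rw [← contMDiffOn_iff_contDiffOn]
  refine (contMDiffOn_extChartAt (n := ∞) (x := x)).comp
    (D.contMDiffOn_symm.mono inter_subset_left) ?_
  intro z hz
  exact hz.2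

/-- The local expression `c ∘ Θₚ⁻¹` of the inclusion `Mᵃ → M` at `p` (`Θₚ` the half-slice
chart of `Mᵃ` at `p`, `c` the extended chart of `M` at `p`) is smooth at `Θₚ p`. [folklore] -/
theorem contDiffAt_extChartAt_comp_symm (p : RegularSublevel h) :
    ContDiffAt ℝ ∞ (extChartAt (𝓡 (k + 1)) (incl h p) ∘ ((halfSliceAtlas h).datum p).Θ.symm)
      (((halfSliceAtlas h).datum p).Θ (incl h p)) := by
  set D := (halfSliceAtlas h).datum p with hD
  set x : M := incl h p with hx
  have hps : x ∈ D.Θ.source := (halfSliceAtlas h).mem_source p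
  have hA : D.Θ x ∈ D.Θ.target ∩ D.Θ.symm ⁻¹' (chartAt (𝔼 (k + 1)) x).source :=
    ⟨D.Θ.map_source hps, by rw [mem_preimage, D.Θ.left_inv hps]; exact mem_chart_source _ x⟩
  exact (contDiffOn_extChartAt_comp_symm D x).contDiffAt
    ((isOpen_target_inter_symm_preimage_chart D x).mem_nhds hA)

/-- **The differential of the inclusion `Mᵃ → M` in a half-slice chart.** In the preferred
(half-slice) chart `Θₚ` of `Mᵃ` at `p` and the preferred chart `c` of `M` at `p`, the inclusion
reads `c ∘ Θₚ⁻¹` on the half-space, so its differential `mfderiv` at `p` is the (honest) derivative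
of the local diffeomorphism `c ∘ Θₚ⁻¹` of `ℝᵏ⁺¹` at `Θₚ p` (Milnor, *Morse theory* (1963),
Thm. 3.1: `Mᵃ` is a smooth submanifold with boundary; the computation of
`RegularSublevel.det_mfderiv_incl_ne_zero`). [folklore] -/
theorem mfderiv_incl_eq_fderiv (p : RegularSublevel h) :
    mfderiv (𝓡∂ (k + 1)) (𝓡 (k + 1)) (incl h) p =
      fderiv ℝ (extChartAt (𝓡 (k + 1)) (incl h p) ∘ ((halfSliceAtlas h).datum p).Θ.symm)
        (((halfSliceAtlas h).datum p).Θ (incl h p)) := by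
  set D := (halfSliceAtlas h).datum p with hD
  set x : M := incl h p with hx
  set c := extChartAt (𝓡 (k + 1)) x with hc
  set z₀ : 𝔼 (k + 1) := D.Θ x with hz₀
  have hps : x ∈ D.Θ.source := (halfSliceAtlas h).mem_source p
  have hz₀t : z₀ ∈ D.Θ.target := D.Θ.map_source hps
  set G : 𝔼 (k + 1) → 𝔼 (k + 1) := c ∘ D.Θ.symm with hG
  have hGd : DifferentiableAt ℝ G z₀ :=
    (contDiffAt_extChartAt_comp_symm h p).differentiableAt (by simp)
  have hGz₀ : G z₀ = c x := by
    show c (D.Θ.symm (D.Θ x)) = c x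
    rw [D.Θ.left_inv hps]
  have hmd : MDifferentiableAt (𝓡∂ (k + 1)) (𝓡 (k + 1)) (incl h) p :=
    (contMDiff_incl h).mdifferentiableAt (by simp)
  rw [hmd.mfderiv]
  have hself : extChartAt (𝓡∂ (k + 1)) p p = z₀ := (halfSliceAtlas h).extChartAt_self_apply p
  have hsymm : (extChartAt (𝓡∂ (k + 1)) p).symm z₀ = p := by
    rw [← hself]; exact extChartAt_to_inv p
  rw [hself]
  have hev : writtenInExtChartAt (𝓡∂ (k + 1)) (𝓡 (k + 1)) p (incl h)
      =ᶠ[𝓝[range (𝓡∂ (k + 1))] z₀] G := by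
    have hmem : D.Θ.target ∈ 𝓝[range (𝓡∂ (k + 1))] z₀ :=
      mem_nhdsWithin_of_mem_nhds (D.Θ.open_target.mem_nhds hz₀t)
    filter_upwards [hmem, self_mem_nhdsWithin] with z hz hzr
    rw [range_modelWithCornersEuclideanHalfSpace] at hzr
    have hz0 : 0 ≤ z 0 := hzr
    show c (incl h ((extChartAt (𝓡∂ (k + 1)) p).symm z)) = c (D.Θ.symm z)
    congr 1
    exact D.coe_extend_chart_symm_of_mem (p := p) hz0 hz
  have hz₀r : z₀ ∈ range (𝓡∂ (k + 1)) := mem_range_modelHalf (D.apply_zero_nonneg hps p.2)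
  have hval : writtenInExtChartAt (𝓡∂ (k + 1)) (𝓡 (k + 1)) p (incl h) z₀ = G z₀ := by
    show c (incl h ((extChartAt (𝓡∂ (k + 1)) p).symm z₀)) = G z₀
    rw [hsymm, hGz₀]
  rw [hev.fderivWithin_eq hval]
  exact hGd.hasFDerivAt.hasFDerivWithinAt.fderivWithin ((𝓡∂ (k + 1)).uniqueDiffOn z₀ hz₀r)

/-- The value of the orientation of `Mᵃ` induced by an orientation `o` of `M`: `±o` according
to the sign of the Jacobian of the inclusion (definitional, `SmoothOrientation.comapOfDetNeZero`).
[folklore] -/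
theorem orientation_apply (o : SmoothOrientation (𝓡 (k + 1)) M) (p : RegularSublevel h) :
    orientation h o p =
      if 0 < LinearMap.det (M := 𝔼 (k + 1))
          (mfderiv (𝓡∂ (k + 1)) (𝓡 (k + 1)) (incl h) p).toLinearMap
      then o (incl h p) else -o (incl h p) := rfl

/-- The orientation of `Mᵃ` induced by `-o` is the opposite of that induced by `o`. [folklore] -/
@[simp]
theorem orientation_neg (o : SmoothOrientation (𝓡 (k + 1)) M) :
    orientation h (-o) = -orientation h o := by
  ext1 p
  rw [SmoothOrientation.neg_apply, orientation_apply, orientation_apply]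
  split_ifs
  · rfl
  · rfl

end RegularSublevel

end Inclusion

/-! ### §3 The identification `∂Mᵃ ≅ ∂M_a` is orientation reversing -/

section SplitOrientation

open BoundaryManifold

/-- Sign bookkeeping for `isOrientationReversing_splitDiffeomorph`: with `d₁ = d₂ · dT` all
nonzero, the signs `±u` attached to `d₂` (negated) and to `d₁` agree iff `dT < 0`. [folklore] -/
theorem neg_ite_eq_ite_iff_neg {α : Type*} [InvolutiveNeg α] {u : α} (hu : u ≠ -u)
    {d₁ d₂ dT : ℝ} (h₁ : d₁ = d₂ * dT) (h₂ : d₂ ≠ 0) (hT : dT ≠ 0) :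
    (-(if 0 < d₂ then u else -u) = if 0 < d₁ then u else -u) ↔ dT < 0 := by
  have hu' : -u ≠ u := fun h => hu h.symm
  rcases lt_or_gt_of_ne h₂ with h2 | h2 <;> rcases lt_or_gt_of_ne hT with hT' | hT'
  · have h1 : 0 < d₁ := h₁ ▸ mul_pos_of_neg_of_neg h2 hT'
    simp [not_lt.2 h2.le, h1, hT']
  · have h1 : ¬ 0 < d₁ := not_lt.2 (h₁ ▸ (mul_neg_of_neg_of_pos h2 hT').le)
    simp [not_lt.2 h2.le, h1, not_lt.2 hT'.le, hu]
  · have h1 : ¬ 0 < d₁ := not_lt.2 (h₁ ▸ (mul_neg_of_pos_of_neg h2 hT').le)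
    simp [h2, h1, hT']
  · have h1 : 0 < d₁ := h₁ ▸ mul_pos h2 hT'
    simp [h2, h1, not_lt.2 hT'.le, hu']

/-- Determinant of a composition of endomorphisms of `ℝⁿ` given as continuous linear maps.
[folklore] -/
theorem det_coe_comp {n : ℕ} (A B : 𝔼 n →L[ℝ] 𝔼 n) :
    LinearMap.det ((A.comp B : 𝔼 n →L[ℝ] 𝔼 n) : 𝔼 n →ₗ[ℝ] 𝔼 n) =
      LinearMap.det (A : 𝔼 n →ₗ[ℝ] 𝔼 n) * LinearMap.det (B : 𝔼 n →ₗ[ℝ] 𝔼 n) := by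
  rw [← LinearMap.det_comp]
  rfl

variable {k : ℕ} {M : Type u} [TopologicalSpace M] [ChartedSpace (𝔼 (k + 1)) M]
  [IsManifold (𝓡 (k + 1)) ∞ M] {f : M → ℝ} {a : ℝ} (h : IsRegularLevel (𝓡 (k + 1)) f a)

namespace RegularSublevel

/-- **The identification `∂Mᵃ ≅ ∂M_a` reverses the boundary orientations.** Let `a` be a
regular level of the smooth function `f` on the manifold without boundary `M` (model
`𝓡 (k + 1)`) and `o` an orientation of `M`.  Orient the regular sublevel set `Mᵃ = {f ≤ a}` and
the regular superlevel set `M_a = {a ≤ f}` by restriction of `o` (`RegularSublevel.orientation`)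
and their boundaries (both the level `f⁻¹(a)`) by the induced boundary orientations, outward
normal first (`SmoothOrientation.boundary`).  Then the canonical diffeomorphism
`splitDiffeomorph h : ∂Mᵃ ≅ ∂M_a` (the identity on points) is **orientation reversing**: the
outward normals of `Mᵃ` and `M_a` along `f⁻¹(a)` are opposite.  (Proof: near a boundary point,
`splitDiffeomorph h` is the boundary restriction of the local reflection `Θ⁻¹ ∘ R ∘ Θ` in a
half-slice chart `Θ` of `Mᵃ`, `R (t, u) = (-t, u)`, whose Jacobian has the sign
`det R = -1` relative to the two induced orientations; `BoundaryManifold.hasFDerivAt_boundaryCharts`.)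
Hirsch, *Differential Topology* (1976), §4.4, p. 103 and Ch. 8 §2; Guillemin–Pollack,
*Differential Topology* (1974), Ch. 3 §2; Milnor, *Lectures on the h-cobordism theorem* (1965),
§1. [cite: HirschDT1976, §4.4 p. 103] -/
theorem isOrientationReversing_splitDiffeomorph (o : SmoothOrientation (𝓡 (k + 1)) M) :
    IsOrientationReversing (orientation h o).boundary (orientation h.const_sub o).boundary
      (splitDiffeomorph h) := by
  classical
  intro z
  -- notation
  set h' := h.const_sub with hh'
  set σ := splitDiffeomorph h with hσ_def
  set w : (𝓡∂ (k + 1)).boundary (RegularSuperlevel h) := σ z with hw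
  set x : M := incl h z.1 with hx_def
  have hfx : f x = a := apply_incl_boundary h z
  have hwx : incl h' w.1 = x := rfl
  set D₁ := (halfSliceAtlas h).datum z.1 with hD₁
  set D₂ := (halfSliceAtlas h').datum w.1 with hD₂
  have hx1 : x ∈ D₁.Θ.source := (halfSliceAtlas h).mem_source z.1
  have hx2 : x ∈ D₂.Θ.source := (halfSliceAtlas h').mem_source w.1
  -- the `0`-th coordinates of the two half-slice charts are `a - f` and `f - a`
  have hΘ₁0 : ∀ q ∈ D₁.Θ.source, D₁.Θ q 0 = a - f q := fun q hq =>
    sublevelAtlas'_datum_apply_zero_of_eq h.contMDiff a _ z.1 hfx hq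
  have hΘ₂0 : ∀ q ∈ D₂.Θ.source, D₂.Θ q 0 = f q - a := by
    intro q hq
    have hw0 : (fun y => a - f y) (incl h' w.1) = 0 := by
      show a - f x = 0
      rw [hfx, sub_self]
    have h0 : D₂.Θ q 0 = 0 - (fun y => a - f y) q :=
      sublevelAtlas'_datum_apply_zero_of_eq h'.contMDiff 0 _ w.1 hw0 hq
    rw [h0]
    ring
  set y₀ : 𝔼 (k + 1) := D₁.Θ x with hy₀
  have hy₀0 : y₀ 0 = 0 := by rw [hy₀, hΘ₁0 x hx1, hfx, sub_self]
  have hy₀t : y₀ ∈ D₁.Θ.target := D₁.Θ.map_source hx1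
  have hRy₀ : reflZero k y₀ = y₀ := reflZero_of_apply_zero_eq_zero hy₀0
  have hsymmy₀ : D₁.Θ.symm y₀ = x := by rw [hy₀, D₁.Θ.left_inv hx1]
  -- the local reflection `Ψ = Θ₁⁻¹ ∘ R ∘ Θ₁` of `M`, defined on the open set `U ∋ x`
  set U : Set M := D₁.Θ.source ∩ D₁.Θ ⁻¹' (reflZero k ⁻¹' D₁.Θ.target) with hU
  have hUopen : IsOpen U :=
    D₁.Θ.continuousOn.isOpen_inter_preimage D₁.Θ.open_source
      (D₁.Θ.open_target.preimage continuous_reflZero)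
  have hxU : x ∈ U := by
    refine ⟨hx1, ?_⟩
    show reflZero k (D₁.Θ x) ∈ D₁.Θ.target
    rw [← hy₀, hRy₀]
    exact hy₀t
  set Ψ : M → M := fun q => D₁.Θ.symm (reflZero k (D₁.Θ q)) with hΨ
  have hΨsrc : ∀ q ∈ U, Ψ q ∈ D₁.Θ.source := fun q hq => D₁.Θ.map_target hq.2
  have hΘΨ : ∀ q ∈ U, D₁.Θ (Ψ q) = reflZero k (D₁.Θ q) := fun q hq => D₁.Θ.right_inv hq.2
  have hfΨ : ∀ q ∈ U, f (Ψ q) = 2 * a - f q := by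
    intro q hq
    have h1 := hΘ₁0 (Ψ q) (hΨsrc q hq)
    rw [hΘΨ q hq, reflZero_apply_zero, hΘ₁0 q hq.1] at h1
    linarith
  have hΨlev : ∀ q ∈ U, f q = a → Ψ q = q := by
    intro q hq hfq
    have h0 : D₁.Θ q 0 = 0 := by rw [hΘ₁0 q hq.1, hfq, sub_self]
    show D₁.Θ.symm (reflZero k (D₁.Θ q)) = q
    rw [reflZero_of_apply_zero_eq_zero h0, D₁.Θ.left_inv hq.1]
  have hΨcont : ContinuousOn Ψ U := by
    refine D₁.Θ.continuousOn_symm.comp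
      (continuous_reflZero.comp_continuousOn (D₁.Θ.continuousOn.mono fun q hq => hq.1)) ?_
    intro q hq
    exact hq.2
  -- the map `Φ : Mᵃ → M_a` extending `σ`: the reflection near `x`, junk elsewhere
  let Φ : RegularSublevel h → RegularSuperlevel h := fun p =>
    if hp : f (incl h p) = a then
      mk h' (incl h p) (le_of_eq ((eq_level_iff_const_sub_eq_zero _).1 hp))
    else if hq : incl h p ∈ U then
      mk h' (Ψ (incl h p)) (by
        show a - f (Ψ (incl h p)) ≤ 0
        rw [hfΨ _ hq]
        have := apply_incl_le h p
        linarith)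
    else w.1
  have hρ : ∀ z', (σ z').1 = Φ z'.1 := by
    intro z'
    have hz' : f (incl h z'.1) = a := apply_incl_boundary h z'
    have hΦz' : Φ z'.1 = mk h' (incl h z'.1)
        (le_of_eq ((eq_level_iff_const_sub_eq_zero _).1 hz')) := dif_pos hz'
    rw [hΦz']
    rfl
  have hΦU : ∀ p : RegularSublevel h, incl h p ∈ U → incl h' (Φ p) = Ψ (incl h p) := by
    intro p hpU
    by_cases hp : f (incl h p) = a
    · have hΦp : Φ p = mk h' (incl h p)
          (le_of_eq ((eq_level_iff_const_sub_eq_zero _).1 hp)) := dif_pos hp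
      rw [hΦp, incl_mk, hΨlev _ hpU hp]
    · have hΦp : Φ p = mk h' (Ψ (incl h p)) (by
          show a - f (Ψ (incl h p)) ≤ 0
          rw [hfΨ _ hpU]
          have := apply_incl_le h p
          linarith) := by
        simp only [Φ, dif_neg hp, dif_pos hpU]
      rw [hΦp, incl_mk]
  have hΦc : ContinuousAt Φ z.1 := by
    rw [(isEmbedding_incl h').isInducing.continuousAt_iff]
    have hev : (incl h' ∘ Φ) =ᶠ[𝓝 z.1] (Ψ ∘ incl h) := by
      have hn : incl h ⁻¹' U ∈ 𝓝 z.1 :=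
        (continuous_incl h).continuousAt.preimage_mem_nhds (hUopen.mem_nhds hxU)
      filter_upwards [hn] with p hp
      exact hΦU p hp
    refine ContinuousAt.congr ?_ hev.symm
    exact ((hΨcont x hxU).continuousAt (hUopen.mem_nhds hxU)).comp
      (continuous_incl h).continuousAt
  -- the smooth model `G = (Θ₂ ∘ Θ₁⁻¹) ∘ R` of `Φ` read in the charts at `z.1`, `w.1`
  set T : 𝔼 (k + 1) → 𝔼 (k + 1) := D₂.Θ ∘ D₁.Θ.symm with hT
  set B : Set (𝔼 (k + 1)) := D₁.Θ.target ∩ D₁.Θ.symm ⁻¹' D₂.Θ.source with hB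
  have hBopen : IsOpen B := D₁.Θ.isOpen_inter_preimage_symm D₂.Θ.open_source
  have hy₀B : y₀ ∈ B := ⟨hy₀t, by rw [mem_preimage, hsymmy₀]; exact hx2⟩
  have hTsmooth : ContDiffOn ℝ ∞ T B := by
    rw [← contMDiffOn_iff_contDiffOn]
    exact D₂.contMDiffOn_toFun.comp (D₁.contMDiffOn_symm.mono inter_subset_left) fun v hv => hv.2
  have hTd : DifferentiableAt ℝ T y₀ :=
    ((hTsmooth y₀ hy₀B).contDiffAt (hBopen.mem_nhds hy₀B)).differentiableAt (by simp)
  have hTy₀ : T y₀ = D₂.Θ x := by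
    show D₂.Θ (D₁.Θ.symm y₀) = D₂.Θ x
    rw [hsymmy₀]
  set G : 𝔼 (k + 1) → 𝔼 (k + 1) := T ∘ reflZero k with hG
  set L : 𝔼 (k + 1) →L[ℝ] 𝔼 (k + 1) := (fderiv ℝ T y₀).comp (reflZero k) with hL_def
  have hGd : HasFDerivAt G L y₀ := by
    have h1 : HasFDerivAt T (fderiv ℝ T y₀) (reflZero k y₀) := by
      rw [hRy₀]
      exact hTd.hasFDerivAt
    exact h1.comp y₀ (reflZero k).hasFDerivAt
  -- `Φ` read in the charts agrees with `G` near `y₀` within the half-space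
  have hy₀ext : extChartAt (𝓡∂ (k + 1)) z.1 z.1 = y₀ :=
    (halfSliceAtlas h).extChartAt_self_apply z.1
  have hτ : (extChartAt (𝓡∂ (k + 1)) w.1 ∘ Φ ∘ (extChartAt (𝓡∂ (k + 1)) z.1).symm)
      =ᶠ[𝓝[range (𝓡∂ (k + 1))] y₀] G := by
    have n1 : ∀ᶠ y in 𝓝[range (𝓡∂ (k + 1))] y₀, y ∈ D₁.Θ.target :=
      mem_nhdsWithin_of_mem_nhds (D₁.Θ.open_target.mem_nhds hy₀t)
    have n2 : ∀ᶠ y in 𝓝[range (𝓡∂ (k + 1))] y₀, D₁.Θ.symm y ∈ U := by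
      refine mem_nhdsWithin_of_mem_nhds ?_
      refine (D₁.Θ.continuousAt_symm hy₀t).preimage_mem_nhds (hUopen.mem_nhds ?_)
      rw [hsymmy₀]
      exact hxU
    have n3 : ∀ᶠ y in 𝓝[range (𝓡∂ (k + 1))] y₀, D₁.Θ.symm (reflZero k y) ∈ D₂.Θ.source := by
      refine mem_nhdsWithin_of_mem_nhds ?_
      have hc : ContinuousAt (fun y => D₁.Θ.symm (reflZero k y)) y₀ := by
        refine ContinuousAt.comp (g := D₁.Θ.symm) ?_ continuous_reflZero.continuousAt
        rw [hRy₀]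
        exact D₁.Θ.continuousAt_symm hy₀t
      refine hc.preimage_mem_nhds (D₂.Θ.open_source.mem_nhds ?_)
      show D₁.Θ.symm (reflZero k y₀) ∈ D₂.Θ.source
      rw [hRy₀, hsymmy₀]
      exact hx2
    filter_upwards [n1, n2, n3, self_mem_nhdsWithin] with y hy1 hy2 hy3 hyr
    rw [range_modelWithCornersEuclideanHalfSpace] at hyr
    have hy0 : 0 ≤ y 0 := hyr
    have hpy : incl h ((extChartAt (𝓡∂ (k + 1)) z.1).symm y) = D₁.Θ.symm y :=
      D₁.coe_extend_chart_symm_of_mem (p := z.1) hy0 hy1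
    have hΦpy : incl h' (Φ ((extChartAt (𝓡∂ (k + 1)) z.1).symm y)) =
        D₁.Θ.symm (reflZero k y) := by
      rw [hΦU _ (hpy ▸ hy2), hpy]
      show D₁.Θ.symm (reflZero k (D₁.Θ (D₁.Θ.symm y))) = _
      rw [D₁.Θ.right_inv hy1]
    have hsrc : Φ ((extChartAt (𝓡∂ (k + 1)) z.1).symm y) ∈ (D₂.chart w.1).source := by
      show incl h' (Φ ((extChartAt (𝓡∂ (k + 1)) z.1).symm y)) ∈ D₂.Θ.source
      rw [hΦpy]
      exact hy3
    show extChartAt (𝓡∂ (k + 1)) w.1 (Φ ((extChartAt (𝓡∂ (k + 1)) z.1).symm y)) =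
      D₂.Θ (D₁.Θ.symm (reflZero k y))
    rw [← hΦpy]
    exact D₂.extend_chart_apply hsrc
  have hτy₀ : (extChartAt (𝓡∂ (k + 1)) w.1 ∘ Φ ∘ (extChartAt (𝓡∂ (k + 1)) z.1).symm) y₀ = G y₀ :=
    hτ.eq_of_nhdsWithin (mem_range_modelHalf hy₀0.ge)
  have hL : HasFDerivWithinAt
      (extChartAt (𝓡∂ (k + 1)) w.1 ∘ Φ ∘ (extChartAt (𝓡∂ (k + 1)) z.1).symm)
      L (range (𝓡∂ (k + 1))) (extChartAt (𝓡∂ (k + 1)) z.1 z.1) := by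
    rw [hy₀ext]
    exact hGd.hasFDerivWithinAt.congr_of_eventuallyEq hτ hτy₀
  -- `det L = -det d(Θ₂ ∘ Θ₁⁻¹)`
  have hdetL : LinearMap.det (L : 𝔼 (k + 1) →ₗ[ℝ] 𝔼 (k + 1)) =
      -LinearMap.det ((fderiv ℝ T y₀ : 𝔼 (k + 1) →L[ℝ] 𝔼 (k + 1)) :
        𝔼 (k + 1) →ₗ[ℝ] 𝔼 (k + 1)) := by
    rw [hL_def, det_coe_comp, det_reflZero, mul_neg_one]
  -- the Jacobians of the two inclusions: `J₁ = J₂ ∘ d(Θ₂ ∘ Θ₁⁻¹)`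
  set c := extChartAt (𝓡 (k + 1)) x with hc
  have hJ₁ : mfderiv (𝓡∂ (k + 1)) (𝓡 (k + 1)) (incl h) z.1 = fderiv ℝ (c ∘ D₁.Θ.symm) y₀ :=
    mfderiv_incl_eq_fderiv h z.1
  have hJ₂ : mfderiv (𝓡∂ (k + 1)) (𝓡 (k + 1)) (incl h') w.1 =
      fderiv ℝ (c ∘ D₂.Θ.symm) (D₂.Θ x) :=
    mfderiv_incl_eq_fderiv h' w.1
  have hchain : fderiv ℝ (c ∘ D₁.Θ.symm) y₀ =
      (fderiv ℝ (c ∘ D₂.Θ.symm) (D₂.Θ x)).comp (fderiv ℝ T y₀) := by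
    have hd2 : DifferentiableAt ℝ (c ∘ D₂.Θ.symm) (D₂.Θ x) :=
      (contDiffAt_extChartAt_comp_symm h' w.1).differentiableAt (by simp)
    have hcomp : HasFDerivAt ((c ∘ D₂.Θ.symm) ∘ T)
        ((fderiv ℝ (c ∘ D₂.Θ.symm) (D₂.Θ x)).comp (fderiv ℝ T y₀)) y₀ := by
      have hd2' : HasFDerivAt (c ∘ D₂.Θ.symm) (fderiv ℝ (c ∘ D₂.Θ.symm) (D₂.Θ x)) (T y₀) := by
        rw [hTy₀]
        exact hd2.hasFDerivAt
      exact hd2'.comp y₀ hTd.hasFDerivAt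
    have hev : ((c ∘ D₂.Θ.symm) ∘ T) =ᶠ[𝓝 y₀] (c ∘ D₁.Θ.symm) := by
      filter_upwards [hBopen.mem_nhds hy₀B] with y hy
      show c (D₂.Θ.symm (D₂.Θ (D₁.Θ.symm y))) = c (D₁.Θ.symm y)
      rw [D₂.Θ.left_inv hy.2]
    exact (hcomp.congr_of_eventuallyEq hev.symm).fderiv
  have hdet₁ : LinearMap.det (M := 𝔼 (k + 1))
        (mfderiv (𝓡∂ (k + 1)) (𝓡 (k + 1)) (incl h) z.1).toLinearMap =
      LinearMap.det (M := 𝔼 (k + 1))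
          (mfderiv (𝓡∂ (k + 1)) (𝓡 (k + 1)) (incl h') w.1).toLinearMap *
        LinearMap.det ((fderiv ℝ T y₀ : 𝔼 (k + 1) →L[ℝ] 𝔼 (k + 1)) :
          𝔼 (k + 1) →ₗ[ℝ] 𝔼 (k + 1)) := by
    have h3 : LinearMap.det ((fderiv ℝ (c ∘ D₁.Θ.symm) y₀ : 𝔼 (k + 1) →L[ℝ] 𝔼 (k + 1)) :
          𝔼 (k + 1) →ₗ[ℝ] 𝔼 (k + 1)) =
        LinearMap.det ((fderiv ℝ (c ∘ D₂.Θ.symm) (D₂.Θ x) : 𝔼 (k + 1) →L[ℝ] 𝔼 (k + 1)) :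
            𝔼 (k + 1) →ₗ[ℝ] 𝔼 (k + 1)) *
          LinearMap.det ((fderiv ℝ T y₀ : 𝔼 (k + 1) →L[ℝ] 𝔼 (k + 1)) :
            𝔼 (k + 1) →ₗ[ℝ] 𝔼 (k + 1)) := by
      rw [hchain, det_coe_comp]
    rw [hJ₁, hJ₂]
    exact h3
  have hd₁ := det_mfderiv_incl_ne_zero h z.1
  have hd₂ := det_mfderiv_incl_ne_zero h' w.1
  have hdT : LinearMap.det ((fderiv ℝ T y₀ : 𝔼 (k + 1) →L[ℝ] 𝔼 (k + 1)) :
      𝔼 (k + 1) →ₗ[ℝ] 𝔼 (k + 1)) ≠ 0 := by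
    intro h0
    rw [h0, mul_zero] at hdet₁
    exact hd₁ hdet₁
  have hLdet : LinearMap.det (L : 𝔼 (k + 1) →ₗ[ℝ] 𝔼 (k + 1)) ≠ 0 := by
    rw [hdetL, neg_ne_zero]
    exact hdT
  -- the core lemma: `σ` in the boundary charts, and the sign of its Jacobian
  have hzc : Φ z.1 ∈ (chartAt (ℍ (k + 1)) w.1).source := by
    rw [← hρ z]
    exact mem_chart_source _ w.1
  have hcore := BoundaryManifold.hasFDerivAt_boundaryCharts hρ z z w (mem_chart_source _ z.1)
    hzc hΦc hL hLdet
  have hmf : HasMFDerivAt (𝓡 k) (𝓡 k) σ z ((tailL k).comp (L.comp (consZeroL k))) := by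
    refine ⟨σ.continuous.continuousAt, ?_⟩
    rw [writtenInExtChartAt, ModelWithCorners.Boundaryless.range_eq_univ,
      BoundaryManifold.extChartAt_coe, BoundaryManifold.extChartAt_symm_coe,
      BoundaryManifold.extChartAt_coe, hasFDerivWithinAt_univ]
    exact hcore.1
  -- bookkeeping
  rw [hmf.mfderiv]
  refine Iff.trans ?_ hcore.2
  rw [SmoothOrientation.neg_apply, SmoothOrientation.boundary_apply,
    SmoothOrientation.boundary_apply, ← boundaryOrientationMap_neg, boundaryOrientationMap_eq_iff,
    orientation_apply, orientation_apply, hdetL, neg_pos]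
  exact neg_ite_eq_ite_iff_neg (Module.Ray.ne_neg_self _) hdet₁ hd₂ hdT

/-- Equivalently: `splitDiffeomorph h : ∂Mᵃ ≅ ∂M_a` is orientation *preserving* from the boundary
orientation of `(Mᵃ, o)` to the boundary orientation of `(M_a, -o)`. [cite: HirschDT1976, §4.4 p. 103] -/
theorem isOrientationPreserving_splitDiffeomorph_neg (o : SmoothOrientation (𝓡 (k + 1)) M) :
    IsOrientationPreserving (orientation h o).boundary (orientation h.const_sub (-o)).boundary
      (splitDiffeomorph h) := by
  rw [orientation_neg, SmoothOrientation.boundary_neg]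
  exact isOrientationReversing_splitDiffeomorph h o

end RegularSublevel

end SplitOrientation

end Literature.Topology.FourManifolds
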